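import Literature.NumberTheory.CubicFields.PsiFourierContent
import Literature.NumberTheory.CubicFields.PsiFourierPeeling
import Literature.NumberTheory.CubicFields.DualWeightOrbitSum
import HarnessLib

/-!
# BTT Proposition 5.2 assembled: `|Ψ̂_{p²}(f)| ≤ localMajorant p f` and the majorant for `Φ_q = Ψ_{q²}`

Topic `Literature/NumberTheory/CubicFields`; assembles `PsiFourierPrimitive.lean` (the normal form: for `f` in the
dual lattice primitive at `p ≥ 5`, `Ψ̂_{p²}(f) ≠ 0` forces `f ∉ U_p`, `p³ ∣ Disc f`, and then `Ψ̂ = p⁻³ − p⁻⁴` if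
`p⁴ ∣ Disc f`, `−p⁻⁴` otherwise), `PsiFourierContent.lean` (`|Ψ̂_{p²}(f)| ≤ 9p⁻³` if `p ∥ f`),
`PsiFourierPeeling.lean` (`|Φ̂_q(f)| ≤ ∏_{p∣q, p≥5} |Ψ̂_{p²}(f)|` for squarefree `q`) into the prime-by-prime majorant
consumed by `DualWeightOrbitSum.lean` / `DualDensityPsiSum.lean` (`localMajorant p f`: `1` if `p² ∣ f`, `9p⁻³` if
`p ∣ f`, `p⁻³` if `f ∉ U_p ∧ p⁴ ∣ Disc`, `p⁻⁴` if `f ∉ U_p ∧ p³ ∣ Disc`, `0` otherwise). Everything here is PROVED.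

Bhargava–Taniguchi–Thorne 2023, Proposition 5.2 (second `Ψ_{p²}`, `p ≠ 2` — here `p ≥ 5`): "`|Ψ̂_{p²}(x)|` = Content
`p²`: `2p⁻² − p⁻⁴`; Content `p`: `O(p⁻³)`; Divisible by `p⁴`: `p⁻³ + O(p⁻⁴)`; Divisible by `p³`: `O(p⁻⁴)`; Divisible
by `p²`: `0`; Otherwise: `0`", with "`p^j ∣ Disc(R)` and `R` is nonmaximal at `p`" in rows 3–5.

* `norm_fourierDual_psiLocal_le_localMajorant` — the five cases at once for `f` in the dual lattice
  (`Content p²`: the trivial bound `1`);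
* **`norm_dualWeight_psiMod_le`** — `‖dualWeight (psiMod q) f‖ ≤ ∏_{p ∈ bigPrimes q} localMajorant p f` for
  squarefree `q` (the hypothesis `hmaj` of `dualDensityPsiBound_of_divCountBound`).

## References

* M. Bhargava, T. Taniguchi, F. Thorne, *Improved error estimates for the Davenport–Heilbronn theorems*,
  Math. Ann. 389 (2024) = arXiv:2107.12819, Prop. 5.2 and the first paragraph of the proof of Prop. 5.1 [BhargavaTaniguchiThorne2023].
-/

noncomputable section

namespace Literature.NumberTheory.CubicFields

open BinaryCubic Finset Classical

section Local

variable {p : ℕ} [hp : Fact p.Prime]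

omit hp in
/-- `|Ψ_{p²}| ≤ 1`. [folklore] -/
theorem norm_psiLocal_le_one (y : BinaryCubic (ZMod (p ^ 2))) : ‖psiLocal p y‖ ≤ 1 := by
  unfold psiLocal; split_ifs <;> simp

/-- **Proposition 5.2, all cases, `p ≥ 5`**: for `f` in the dual lattice, `|Ψ̂_{p²}(f)| ≤ localMajorant p f`.
[cite: BhargavaTaniguchiThorne2023, Prop. 5.2] -/
theorem norm_fourierDual_psiLocal_le_localMajorant (hp5 : 5 ≤ p) {f : BinaryCubic ℤ} (hf : IsDualForm f) :
    ‖fourierDual (psiLocal p) f‖ ≤ localMajorant p f := by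
  have hp0 : (0 : ℝ) < p := by exact_mod_cast hp.out.pos
  unfold localMajorant
  by_cases h2 : ClsC2 f p
  · rw [if_pos h2]
    exact norm_fourierDual_le (fun y => norm_psiLocal_le_one y) f
  rw [if_neg h2]
  by_cases h1 : ClsC1 f p
  · rw [if_pos h1]
    exact norm_fourierDual_psiLocal_le_of_isMultiple hp5 hf h1 h2
  rw [if_neg h1]
  by_cases hne : fourierDual (psiLocal p) f = 0
  · rw [hne, norm_zero]
    split_ifs <;> positivity
  obtain ⟨hU, h3, hval⟩ := fourierDual_psiLocal_of_ne_zero hp5 hf h1 hne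
  have hp3c : ((p : ℂ) ^ 3)⁻¹ = (((p : ℝ) ^ 3)⁻¹ : ℝ) := by push_cast; rfl
  have hp4c : ((p : ℂ) ^ 4)⁻¹ = (((p : ℝ) ^ 4)⁻¹ : ℝ) := by push_cast; rfl
  by_cases h4 : (p : ℤ) ^ 4 ∣ f.disc
  · have hD4 : ClsD4 f p := ⟨hU, h4⟩
    rw [if_pos hD4, hval, if_pos h4, hp3c, hp4c, ← Complex.ofReal_sub, Complex.norm_real, Real.norm_eq_abs,
      abs_of_nonneg]
    · linarith [show 0 < ((p : ℝ) ^ 4)⁻¹ by positivity]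
    · have hp1 : (1 : ℝ) ≤ p := by exact_mod_cast hp.out.one_lt.le
      have : ((p : ℝ) ^ 4)⁻¹ ≤ ((p : ℝ) ^ 3)⁻¹ := inv_anti₀ (by positivity) (pow_le_pow_right₀ hp1 (by norm_num))
      linarith
  · have hD4 : ¬ ClsD4 f p := fun h => h4 h.2
    have hD3 : ClsD3 f p := ⟨hU, h3⟩
    rw [if_neg hD4, if_pos hD3, hval, if_neg h4, norm_neg, hp4c, Complex.norm_real, Real.norm_eq_abs,
      abs_of_nonneg (by positivity)]

end Local

/-- **The Fourier majorant for `Φ_q = Ψ_{q²}`**, squarefree `q`: `‖dualWeight Φ_q f‖ ≤ ∏_{p ∣ q, p ≥ 5} localMajorant p f`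
(peeling `PsiFourierPeeling` + the local bound; off the dual lattice the weight is `0`). This is the hypothesis
`hmaj` of `DualDensityPsiSum.dualDensityPsiBound_of_divCountBound`.
[cite: BhargavaTaniguchiThorne2023, Prop. 5.2 with the first paragraph of the proof of Prop. 5.1 (multiplicativity over p ∣ q)] -/
theorem norm_dualWeight_psiMod_le {q : ℕ} (hq : Squarefree q) (f : BinaryCubic ℤ) :
    ‖dualWeight (psiMod q) f‖ ≤ ∏ p ∈ bigPrimes q, localMajorant p f := by
  unfold dualWeight
  split_ifs with hf
  · rw [Complex.norm_real, Real.norm_of_nonneg (norm_nonneg _)]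
    refine (norm_fourierDual_psiMod_le hq hf).trans ?_
    refine Finset.prod_le_prod (fun p _ => norm_nonneg _) fun p hp => ?_
    haveI := Fact.mk (prime_of_mem_bigPrimes hp)
    exact norm_fourierDual_psiLocal_le_localMajorant (five_le_of_mem_bigPrimes hp) hf
  · rw [norm_zero]
    exact Finset.prod_nonneg fun p _ => localMajorant_nonneg p f

end Literature.NumberTheory.CubicFields

end
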